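import Mathlib
import Summits.Ventures.PercRepro2.StrandMany
import Summits.Ventures.PercRepro2.SeriesSum

/-!
# Row B2 on series–parallel compositions of small strands (seat mine-b, cell pub-perc-repro2)

`LCNet ends s t E₀` is the class of two-terminal networks (edge sets with a pair of terminals)
generated from parts carrying at most two edge-disjoint terminal paths (`atom`) by parallel
composition (parts sharing only the terminals, `par`) and series composition (parts sharing only
a cut vertex, `ser`).  By `StrandMany.lean` (convolution of log-concave tails) and `SeriesSum.lean`
(product of log-concave tails) every network of the class has a log-concave flow tail
(`LCNet.isLCTail`), so **row B2 — `P(F ≥ k)·P(F ≥ k+2) ≤ P(F ≥ k+1)²` for the max-flow `F` —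
holds for every product measure on every graph of the class** (`flow_logconcave_of_LCNet`).
The class contains every series–parallel graph (single edges are atoms, `LCNet.of_card_le_two`)
and every graph whose strands carry at most two disjoint paths, and is closed under the two
compositions — e.g. a Wheatstone bridge in series with a `K₄`, in parallel with a path.
-/

open Finset

namespace Summit.Ventures.PercRepro2

open IFR

variable {V : Type*} {E : Type*} [Fintype E] [DecidableEq E]

/-- **two-terminal networks with log-concave flow by construction**: parts carrying at most two
edge-disjoint terminal paths (`atom`), closed under parallel composition of parts sharing only
the terminals (`par`) and series composition of parts sharing only a cut vertex (`ser`). -/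
inductive LCNet (ends : E → Sym2 V) : V → V → Finset E → Prop
  | atom {s t : V} {E₁ : Finset E} (hst : s ≠ t) (h3 : flowIn ends s t E₁ 3 = ∅) :
      LCNet ends s t E₁
  | par {s t : V} {E₁ E₂ : Finset E} (hst : s ≠ t) (hE : SharesOnlyTerminals ends s t E₁ E₂)
      (hd : Disjoint E₁ E₂) (h₁ : LCNet ends s t E₁) (h₂ : LCNet ends s t E₂) :
      LCNet ends s t (E₁ ∪ E₂)
  | ser {s v t : V} {E₁ E₂ : Finset E} (hE : SharesOnlyVertex ends v E₁ E₂)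
      (hs : ∀ e ∈ E₂, s ∉ ends e) (ht : ∀ e ∈ E₁, t ∉ ends e) (hsv : s ≠ v) (htv : t ≠ v)
      (hst : s ≠ t) (hd : Disjoint E₁ E₂) (h₁ : LCNet ends s v E₁) (h₂ : LCNet ends v t E₂) :
      LCNet ends s t (E₁ ∪ E₂)

/-- the terminals of a network are distinct -/
theorem LCNet.ne {ends : E → Sym2 V} {s t : V} {E₀ : Finset E} (h : LCNet ends s t E₀) : s ≠ t := by
  cases h with
  | atom hst _ => exact hst
  | par hst _ _ _ _ => exact hst
  | ser _ _ _ _ _ hst _ _ _ => exact hst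

/-- a part with at most two edges is an atom (it cannot carry three disjoint paths) -/
theorem LCNet.of_card_le_two {ends : E → Sym2 V} {s t : V} (hst : s ≠ t) {E₁ : Finset E}
    (h : E₁.card ≤ 2) : LCNet ends s t E₁ :=
  LCNet.atom hst (flowIn_eq_empty hst E₁ (by omega))

/-- **every network of the class has a log-concave flow tail** -/
theorem LCNet.isLCTail {p : E → ℝ} (hp : IsProbVec p) {ends : E → Sym2 V} {s t : V} {E₀ : Finset E}
    (h : LCNet ends s t E₀) : IsLCTail (flowTail p ends s t E₀) ((E₀.card : ℤ) + 1) := by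
  induction h with
  | atom hst h3 => exact isLCTail_flowTail hp hst _ (flowIn_logconcave_of_no_three hp _ _ _ _ h3)
  | par hst hE hd _ _ ih₁ ih₂ => exact isLCTail_flowTail_union' p hst hE hd ih₁ ih₂
  | ser hE hs ht hsv htv hst hd _ _ ih₁ ih₂ =>
    exact isLCTail_flowTail_series' p hE hs ht hsv htv hst hd ih₁ ih₂

/-- row B2 inside a network of the class, at every level -/
theorem LCNet.flowIn_logconcave {p : E → ℝ} (hp : IsProbVec p) {ends : E → Sym2 V} {s t : V}
    {E₀ : Finset E} (h : LCNet ends s t E₀) (k : ℕ) :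
    prob p (flowIn ends s t E₀ k) * prob p (flowIn ends s t E₀ (k + 2))
      ≤ prob p (flowIn ends s t E₀ (k + 1)) * prob p (flowIn ends s t E₀ (k + 1)) := by
  have hk := (h.isLCTail hp).lc ((k : ℤ) + 1)
  have e1 : ((k : ℤ) + 1 - 1) = (k : ℤ) := by ring
  have e2 : ((k : ℤ) + 1 + 1) = ((k + 2 : ℕ) : ℤ) := by push_cast; ring
  have e3 : ((k : ℤ) + 1) = ((k + 1 : ℕ) : ℤ) := by push_cast; ring
  rw [e1, e2, e3, flowTail_natCast, flowTail_natCast, flowTail_natCast] at hk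
  exact hk

/-- **Row B2 on every series–parallel composition of strands with at most two edge-disjoint
terminal paths**: if the whole edge set is a network of the class, then
`P(F ≥ k)·P(F ≥ k+2) ≤ P(F ≥ k+1)²` for every product measure and every `k`. -/
theorem flow_logconcave_of_LCNet {p : E → ℝ} (hp : IsProbVec p) {ends : E → Sym2 V} {s t : V}
    (h : LCNet ends s t Finset.univ) (k : ℕ) :
    prob p (flowEvent ends s t k) * prob p (flowEvent ends s t (k + 2))
      ≤ prob p (flowEvent ends s t (k + 1)) * prob p (flowEvent ends s t (k + 1)) := by
  have hk := h.flowIn_logconcave hp k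
  rw [flowIn_univ, flowIn_univ, flowIn_univ] at hk
  exact hk

end Summit.Ventures.PercRepro2
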